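import Mathlib
import Summits.Ventures.PercRepro2.HCov
import Summits.Ventures.PercRepro2.RootLeafUSigns
import Summits.Ventures.PercRepro2.RootLeafUSecond
import Summits.Ventures.PercRepro2.RootLeafUHalf
import Summits.Ventures.PercRepro2.RootLeafUMixK

/-!
# (G4-u), the `o ∈ K` half: the class `A ≥ 2β` is a THEOREM — (MIX-K) at `ρ = 1` is BHK06
(blind cell PercRepro2, p4 g13; S3 item (aa); no definitions)

RootLeafUMixK: `P₀·T2oK = A·ℋ′ + 2β·X_b + ℰ·(e0P₀ − d0P_o)` and (MIX-K) `0 ≤ A·ℋ′ + 2β·X_b` ⟹ `0 ≤ T2oK`.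
In the ρ-form (MIX-K) is `Cov'(1_{c∈L}·(1_{b∈K} − ρ) − 1_{b∈L}, 1_{o∈K}) ≥ 0` with `ρ = A/(2β)`, and the
covariance is increasing in `ρ`.  At `ρ = 1` the functional is `−1_{b∉K}·(1_{c∈L} + 1_{b∈L})`, whose
conditional expectation given `K = C(a₂)` is `−χ_{b∉K}(K)·(g_c(K) + g_b(K))` with `g_x(K) = P_{G−K}(u ↔ x)`
— a DECREASING functional of the cluster `K` — so its covariance with `1_{o∈K}` is `≤ 0` by the functional
BHK06 Thm 1.3 (`bhk_induced`, cluster of `a₂` avoiding `{u, c}`, `F₁ = 1_{o∈·}`, `F₂ = 2 − χ·(g_c + g_b)`):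

* **`HoK_add_Xb_nonneg`**: `0 ≤ ℋ′ + X_b` (= (MIX-K) at `ρ = 1`, cleared);
* **`T2oK_nonneg_of_two_beta_le`**: `2β ≤ A → 0 ≤ T2oK` — since `A·ℋ′ + 2β·X_b = (A − 2β)·ℋ′ + 2β·(ℋ′ + X_b)`
  with `ℋ′ ≥ 0` (`HoK_nonneg`) and `β ≥ 0`.

So the `o ∈ K` half of W1 holds UNCONDITIONALLY on the class `A ≥ 2β` (`A = α + κ`, `β = S·D + d0·Z`,
RootLeafUHalf; ≈ 30 % of random instances, every instance with `ρ = A/2β ≥ 1`), and what is open is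
the range `A < 2β`, where (MIX-K) asks for the share `ρ < 1` (census: `ρ ≥ P(bK | PD, o∉K)` suffices,
0 / 221 content instances).
-/

namespace Summit.Ventures.PercRepro2

open UnionCluster CovForm

namespace RootLeafU

namespace MixK

variable {V : Type*} {E : Type*} [Fintype E] [DecidableEq E] [Fintype V] [DecidableEq V]
  {R : Type*} [Field R] [LinearOrder R] [IsStrictOrderedRing R]

section Sets

variable (ends : E → Sym2 V) (o a₂ c b u : V)

omit [Fintype E] [DecidableEq E] [Fintype V] in
/-- `{K avoids {u, c}} ∩ {u ↔ c} = T′`. -/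
lemma N_inter_uc_eq :
    avoidAll ends a₂ {u, c} ∩ connEvent ends u c = TEvent ends a₂ u c := by
  rw [Set.inter_comm, conn_inter_R]

omit [Fintype E] [DecidableEq E] [Fintype V] in
/-- `{K avoids {u, c}} ∩ {u ↮ c} = PD`. -/
lemma N_inter_uc_compl_eq :
    avoidAll ends a₂ {u, c} ∩ (connEvent ends u c)ᶜ = PDEvent ends u a₂ c := by
  rw [← PDEvent_root_swap ends u a₂ c, ISplit.PD_eq_R_inter]

omit [Fintype E] [DecidableEq E] [Fintype V] [DecidableEq V] in
/-- `clusterInEvent x {W | v ∉ W} = {x ↮ v}`. -/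
lemma clusterInEvent_notMem_eq (x v : V) :
    clusterInEvent ends x {W : Set V | v ∉ W} = (connEvent ends x v)ᶜ := by
  ext ω
  simp only [mem_clusterInEvent, Set.mem_setOf_eq, cluster, Set.mem_compl_iff, mem_connEvent]

omit [Fintype E] [DecidableEq E] [Fintype V] [DecidableEq V] in
/-- `clusterInEvent x ({W | v ∈ W} ∩ {W | w ∉ W}) = {x ↔ v} ∩ {x ↮ w}`. -/
lemma clusterInEvent_mem_notMem_eq (x v w : V) :
    clusterInEvent ends x ({W : Set V | v ∈ W} ∩ {W | w ∉ W}) =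
      connEvent ends x v ∩ (connEvent ends x w)ᶜ := by
  ext ω
  simp only [mem_clusterInEvent, Set.mem_inter_iff, Set.mem_setOf_eq, cluster, Set.mem_compl_iff,
    mem_connEvent]

end Sets

section Masses

variable (p : E → R) (ends : E → Sym2 V) (o a₂ c b u : V)

omit [Fintype V] [LinearOrder R] [IsStrictOrderedRing R] in
/-- `P(N ∩ X) = P(PD ∩ X) + P(T′ ∩ X)` for `N = {K avoids {u, c}}`. -/
lemma prob_N_inter (X : Set (Config E)) :
    prob p (avoidAll ends a₂ {u, c} ∩ X) =
      prob p (PDEvent ends u a₂ c ∩ X) + prob p (TEvent ends a₂ u c ∩ X) := by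
  have h := prob_inter_add_prob_inter_compl p (avoidAll ends a₂ {u, c} ∩ X) (connEvent ends u c)
  have e1 : avoidAll ends a₂ {u, c} ∩ X ∩ connEvent ends u c = TEvent ends a₂ u c ∩ X := by
    rw [← N_inter_uc_eq ends a₂ c u]
    ext ω
    simp only [Set.mem_inter_iff]
    tauto
  have e2 : avoidAll ends a₂ {u, c} ∩ X ∩ (connEvent ends u c)ᶜ = PDEvent ends u a₂ c ∩ X := by
    rw [← N_inter_uc_compl_eq ends a₂ c u]
    ext ω
    simp only [Set.mem_inter_iff, Set.mem_compl_iff]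
    tauto
  rw [e1, e2] at h
  linear_combination -h

end Masses

section BHK

variable (p : E → R) (ends : E → Sym2 V) (o a₂ c b u : V)

/-- **The BHK step**: `Cov'(1_{b∉K}·(1_{c∈L} + 1_{b∈L}), 1_{o∈K}) ≤ 0` under `P(· | K avoids {u, c})`,
cleared: `[P(T′,oK) − P(T′,bK,oK) + P(PD,bL,oK) + P(T′,bL,oK)]·P₀ ≤ [t′ − P(T′,bK) + P(PD,bL) + P(T′,bL)]·P_o`
(`bhk_induced` on the cluster of `a₂` avoiding `{u, c}`, `F₁ = 1_{o∈·}`, `F₂ = 2 − χ_{b∉·}·(g_c + g_b)`). -/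
theorem cov_bnotK_le (hp : IsProbVec p) :
    (prob p (TEvent ends a₂ u c ∩ connEvent ends a₂ o) -
        prob p (TEvent ends a₂ u c ∩ (connEvent ends a₂ o ∩ connEvent ends a₂ b)) +
        prob p (PDEvent ends u a₂ c ∩ (connEvent ends a₂ o ∩ connEvent ends u b)) +
        prob p (TEvent ends a₂ u c ∩ (connEvent ends a₂ o ∩ connEvent ends u b))) *
      (prob p (PDEvent ends u a₂ c) + prob p (TEvent ends a₂ u c)) ≤
    (prob p (TEvent ends a₂ u c) - prob p (TEvent ends a₂ u c ∩ connEvent ends a₂ b) +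
        prob p (PDEvent ends u a₂ c ∩ connEvent ends u b) +
        prob p (TEvent ends a₂ u c ∩ connEvent ends u b)) *
      (prob p (PDEvent ends u a₂ c ∩ connEvent ends a₂ o) +
        prob p (TEvent ends a₂ u c ∩ connEvent ends a₂ o)) := by
  classical
  set N := avoidAll ends a₂ {u, c} with hN
  have hu : u ∈ ({u, c} : Finset V) := by simp
  set gc := delClusterProb p ends u {W | c ∈ W} with hgc
  set gb := delClusterProb p ends u {W | b ∈ W} with hgb
  set χ : Set V → R := fun K => ({W : Set V | b ∉ W}).indicator 1 K with hχ
  -- tower identities (exploring `K = C(a₂)` avoiding `{u, c}`)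
  have tN := prob_clusterIn_inter_avoid_eq_expect p ends a₂ u hu Set.univ Set.univ
  have tO := prob_clusterIn_inter_avoid_eq_expect p ends a₂ u hu {W | o ∈ W} Set.univ
  have tBc := prob_clusterIn_inter_avoid_eq_expect p ends a₂ u hu {W | b ∉ W} {W | c ∈ W}
  have tBb := prob_clusterIn_inter_avoid_eq_expect p ends a₂ u hu {W | b ∉ W} {W | b ∈ W}
  have tOBc := prob_clusterIn_inter_avoid_eq_expect p ends a₂ u hu ({W | o ∈ W} ∩ {W | b ∉ W})
    {W | c ∈ W}
  have tOBb := prob_clusterIn_inter_avoid_eq_expect p ends a₂ u hu ({W | o ∈ W} ∩ {W | b ∉ W})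
    {W | b ∈ W}
  have hg1 : ∀ K, delClusterProb p ends u Set.univ K = 1 := delClusterProb_univ p ends u
  simp only [clusterInEvent_univ, Set.univ_inter, Set.inter_univ, Set.indicator_univ,
    Pi.one_apply, one_mul, hg1, mul_one] at tN tO tBc tBb tOBc tOBb
  -- monotonicity and bounds of the functionals
  have hgc_anti : Antitone gc := delClusterProb_anti p hp ends u (ExploreA3.isUpperSet_mem c)
  have hgb_anti : Antitone gb := delClusterProb_anti p hp ends u (ExploreA3.isUpperSet_mem b)
  have hgc1 : ∀ K, gc K ≤ 1 := delClusterProb_le_one p hp ends u _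
  have hgb1 : ∀ K, gb K ≤ 1 := delClusterProb_le_one p hp ends u _
  have hgc0 : ∀ K, 0 ≤ gc K := delClusterProb_nonneg p hp ends u _
  have hgb0 : ∀ K, 0 ≤ gb K := delClusterProb_nonneg p hp ends u _
  have hχ_anti : Antitone χ := by
    intro K K' h
    simp only [hχ]
    by_cases hb' : b ∈ K
    · have hb'' : b ∈ K' := h hb'
      simp [Set.indicator, hb', hb'']
    · simp only [Set.indicator, Set.mem_setOf_eq, hb', not_false_eq_true, if_true, Pi.one_apply]
      split_ifs <;> norm_num
  have hχ0 : ∀ K, 0 ≤ χ K := fun K => Set.indicator_apply_nonneg fun _ => zero_le_one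
  have hχ1 : ∀ K, χ K ≤ 1 := fun K => Set.indicator_apply_le' (fun _ => le_rfl) (fun _ => zero_le_one)
  have hF₁ : Monotone (fun K : Set V => ({W : Set V | o ∈ W}).indicator (1 : Set V → R) K) :=
    monotone_indicator_one_of_isUpperSet (ExploreA3.isUpperSet_mem o)
  have hF₁0 : ∀ K, 0 ≤ ({W : Set V | o ∈ W}).indicator (1 : Set V → R) K :=
    fun K => Set.indicator_apply_nonneg fun _ => zero_le_one
  have hF₂ : Monotone (fun K => 2 - χ K * (gc K + gb K)) := by
    intro K K' h
    simp only
    have h1 := hχ_anti h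
    have h2 : gc K' + gb K' ≤ gc K + gb K := by linarith [hgc_anti h, hgb_anti h]
    have : χ K' * (gc K' + gb K') ≤ χ K * (gc K + gb K) :=
      mul_le_mul h1 h2 (by linarith [hgc0 K', hgb0 K']) (hχ0 K)
    linarith
  have hF₂0 : ∀ K, 0 ≤ 2 - χ K * (gc K + gb K) := by
    intro K
    have : χ K * (gc K + gb K) ≤ 1 * 2 :=
      mul_le_mul (hχ1 K) (by linarith [hgc1 K, hgb1 K]) (by linarith [hgc0 K, hgb0 K]) zero_le_one
    linarith
  -- the functional BHK on the cluster of `a₂` avoiding `{u, c}`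
  have key := bhk_induced p hp ends a₂ hF₁ hF₂ hF₁0 hF₂0 Finset.univ {u, c} {u, c}
    (Finset.subset_univ _) (Finset.subset_univ _)
  simp only [Finset.inter_self, Finset.union_self, REvent_univ] at key
  have e : ∀ F : Set V → R, clusterObs ends Finset.univ a₂ F * (avoidAll ends a₂ {u, c}).indicator 1 =
      fun ω => F (cluster ends ω a₂) * (avoidAll ends a₂ {u, c}).indicator 1 ω := by
    intro F
    funext ω
    simp only [Pi.mul_apply, clusterObs_apply, clusterIn_univ]
  rw [e, e, e] at key
  simp only [Pi.mul_apply] at key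
  have eN : prob p N = expect p fun ω => N.indicator 1 ω := prob_eq_expect_indicator p _
  -- the three expectations in terms of masses
  have e1 : expect p (fun ω => ({W : Set V | o ∈ W}).indicator (1 : Set V → R) (cluster ends ω a₂) *
      N.indicator 1 ω) = prob p (clusterInEvent ends a₂ {W | o ∈ W} ∩ N) := by
    rw [tO]
  have e2 : expect p (fun ω => (2 - χ (cluster ends ω a₂) *
      (gc (cluster ends ω a₂) + gb (cluster ends ω a₂))) * N.indicator 1 ω) =
      2 * prob p N - prob p (clusterInEvent ends a₂ {W | b ∉ W} ∩ clusterInEvent ends u {W | c ∈ W} ∩ N) -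
        prob p (clusterInEvent ends a₂ {W | b ∉ W} ∩ clusterInEvent ends u {W | b ∈ W} ∩ N) := by
    rw [tBc, tBb, eN, ← expect_const_mul, ← expect_sub, ← expect_sub]
    congr 1
    funext ω
    simp only [Pi.sub_apply, hχ]
    ring
  have e12 : expect p (fun ω => ({W : Set V | o ∈ W}).indicator (1 : Set V → R) (cluster ends ω a₂) *
      (2 - χ (cluster ends ω a₂) * (gc (cluster ends ω a₂) + gb (cluster ends ω a₂))) *
      N.indicator 1 ω) =
      2 * prob p (clusterInEvent ends a₂ {W | o ∈ W} ∩ N) -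
        prob p (clusterInEvent ends a₂ ({W | o ∈ W} ∩ {W | b ∉ W}) ∩ clusterInEvent ends u {W | c ∈ W} ∩ N) -
        prob p (clusterInEvent ends a₂ ({W | o ∈ W} ∩ {W | b ∉ W}) ∩ clusterInEvent ends u {W | b ∈ W} ∩ N) := by
    rw [tO, tOBc, tOBb, ← expect_const_mul, ← expect_sub, ← expect_sub]
    congr 1
    funext ω
    simp only [Pi.sub_apply, hχ, Set.inter_indicator_one, Pi.mul_apply]
    ring
  rw [e1, e2, e12] at key
  -- translate the cluster events to connection events and `N ∩ X` to the `PD` / `T′` masses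
  simp only [ExploreA3.clusterInEvent_mem_eq, clusterInEvent_notMem_eq, clusterInEvent_mem_notMem_eq]
    at key
  have m1 : prob p (connEvent ends a₂ o ∩ N) =
      prob p (PDEvent ends u a₂ c ∩ connEvent ends a₂ o) + prob p (TEvent ends a₂ u c ∩ connEvent ends a₂ o) := by
    rw [Set.inter_comm, prob_N_inter]
  have m2 : prob p ((connEvent ends a₂ b)ᶜ ∩ connEvent ends u c ∩ N) =
      prob p (TEvent ends a₂ u c) - prob p (TEvent ends a₂ u c ∩ connEvent ends a₂ b) := by
    have h := prob_inter_add_prob_inter_compl p (TEvent ends a₂ u c) (connEvent ends a₂ b)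
    have ee : (connEvent ends a₂ b)ᶜ ∩ connEvent ends u c ∩ N = TEvent ends a₂ u c ∩ (connEvent ends a₂ b)ᶜ := by
      rw [← N_inter_uc_eq ends a₂ c u]
      ext ω
      simp only [Set.mem_inter_iff, Set.mem_compl_iff]
      tauto
    rw [ee]
    linarith
  have m3 : prob p ((connEvent ends a₂ b)ᶜ ∩ connEvent ends u b ∩ N) =
      prob p (PDEvent ends u a₂ c ∩ connEvent ends u b) + prob p (TEvent ends a₂ u c ∩ connEvent ends u b) := by
    have ee : (connEvent ends a₂ b)ᶜ ∩ connEvent ends u b ∩ N = N ∩ connEvent ends u b := by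
      ext ω
      simp only [Set.mem_inter_iff, Set.mem_compl_iff, hN, mem_avoidAll, Finset.mem_insert,
        Finset.mem_singleton, forall_eq_or_imp, forall_eq, mem_connEvent]
      constructor
      · rintro ⟨⟨_, hub⟩, hN'⟩
        exact ⟨hN', hub⟩
      · rintro ⟨⟨hua, hca⟩, hub⟩
        refine ⟨⟨fun hab => hua (conn_trans hab (conn_symm hub)), hub⟩, hua, hca⟩
    rw [ee, prob_N_inter]
  have m4 : prob p (connEvent ends a₂ o ∩ (connEvent ends a₂ b)ᶜ ∩ connEvent ends u c ∩ N) =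
      prob p (TEvent ends a₂ u c ∩ connEvent ends a₂ o) -
        prob p (TEvent ends a₂ u c ∩ (connEvent ends a₂ o ∩ connEvent ends a₂ b)) := by
    have h := prob_inter_add_prob_inter_compl p (TEvent ends a₂ u c ∩ connEvent ends a₂ o) (connEvent ends a₂ b)
    have ee : connEvent ends a₂ o ∩ (connEvent ends a₂ b)ᶜ ∩ connEvent ends u c ∩ N =
        TEvent ends a₂ u c ∩ connEvent ends a₂ o ∩ (connEvent ends a₂ b)ᶜ := by
      rw [← N_inter_uc_eq ends a₂ c u]
      ext ω
      simp only [Set.mem_inter_iff, Set.mem_compl_iff]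
      tauto
    have ee2 : TEvent ends a₂ u c ∩ connEvent ends a₂ o ∩ connEvent ends a₂ b =
        TEvent ends a₂ u c ∩ (connEvent ends a₂ o ∩ connEvent ends a₂ b) := Set.inter_assoc _ _ _
    rw [ee2] at h
    rw [ee]
    linarith
  have m5 : prob p (connEvent ends a₂ o ∩ (connEvent ends a₂ b)ᶜ ∩ connEvent ends u b ∩ N) =
      prob p (PDEvent ends u a₂ c ∩ (connEvent ends a₂ o ∩ connEvent ends u b)) +
        prob p (TEvent ends a₂ u c ∩ (connEvent ends a₂ o ∩ connEvent ends u b)) := by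
    have ee : connEvent ends a₂ o ∩ (connEvent ends a₂ b)ᶜ ∩ connEvent ends u b ∩ N =
        N ∩ (connEvent ends a₂ o ∩ connEvent ends u b) := by
      ext ω
      simp only [Set.mem_inter_iff, Set.mem_compl_iff, hN, mem_avoidAll, Finset.mem_insert,
        Finset.mem_singleton, forall_eq_or_imp, forall_eq, mem_connEvent]
      constructor
      · rintro ⟨⟨⟨hao, _⟩, hub⟩, hN'⟩
        exact ⟨hN', hao, hub⟩
      · rintro ⟨⟨hua, hca⟩, hao, hub⟩
        exact ⟨⟨⟨hao, fun hab => hua (conn_trans hab (conn_symm hub))⟩, hub⟩, hua, hca⟩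
    rw [ee, prob_N_inter]
  have mN : prob p N = prob p (PDEvent ends u a₂ c) + prob p (TEvent ends a₂ u c) := by
    have h := prob_N_inter p ends a₂ c u Set.univ
    simpa only [Set.inter_univ] using h
  rw [m1, m2, m3, m4, m5, mN] at key
  nlinarith [key]

/-- **`0 ≤ ℋ′ + X_b`** — (MIX-K) at `ρ = 1`, a consequence of the BHK step. -/
theorem HoK_add_Xb_nonneg (hp : IsProbVec p) :
    0 ≤ (prob p (TEvent ends a₂ u c) * prob p (PDEvent ends u a₂ c ∩ connEvent ends a₂ o) -
          prob p (PDEvent ends u a₂ c) * prob p (TEvent ends a₂ u c ∩ connEvent ends a₂ o)) +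
        (prob p (TEvent ends a₂ u c ∩ (connEvent ends a₂ o ∩ connEvent ends a₂ b)) *
            (prob p (PDEvent ends u a₂ c) + prob p (TEvent ends a₂ u c)) -
          prob p (TEvent ends a₂ u c ∩ connEvent ends a₂ b) *
            (prob p (PDEvent ends u a₂ c ∩ connEvent ends a₂ o) +
              prob p (TEvent ends a₂ u c ∩ connEvent ends a₂ o)) -
          (prob p (PDEvent ends u a₂ c ∩ (connEvent ends a₂ o ∩ connEvent ends u b)) +
              prob p (TEvent ends a₂ u c ∩ (connEvent ends a₂ o ∩ connEvent ends u b))) *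
            (prob p (PDEvent ends u a₂ c) + prob p (TEvent ends a₂ u c)) +
          (prob p (PDEvent ends u a₂ c ∩ connEvent ends u b) +
              prob p (TEvent ends a₂ u c ∩ connEvent ends u b)) *
            (prob p (PDEvent ends u a₂ c ∩ connEvent ends a₂ o) +
              prob p (TEvent ends a₂ u c ∩ connEvent ends a₂ o))) := by
  have h := cov_bnotK_le p ends o a₂ c b u hp
  nlinarith [h]

end BHK

section Class

variable (p : E → R) (ends : E → Sym2 V) (o a₂ c b u : V)

/-- **The class `A ≥ 2β`: `0 ≤ T2oK` unconditionally** (`A = α + κ`, `β = S·D + d0·Z`). -/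
theorem T2oK_nonneg_of_two_beta_le (hp : IsProbVec p)
    (hA : 2 * (prob p Set.univ * prob p (PDEvent ends u a₂ c) +
        prob p (avoidAll ends a₂ {c}) * prob p (avoidAll ends a₂ {u})) ≤
      (prob p (PDEvent ends u a₂ c) * prob p (connEvent ends a₂ b) +
          prob p (avoidAll ends a₂ {c}) * gap p ends u a₂ b) +
        (prob p Set.univ * EQb3 p ends u a₂ c b + prob p Set.univ * PDb p ends u a₂ c b +
          prob p (connEvent ends a₂ b) * EQ3 p ends u a₂ c +
          prob p (connEvent ends a₂ b) * prob p (avoidAll ends a₂ {u}) -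
          (prob p Set.univ - prob p (avoidAll ends a₂ {c})) * gap p ends u a₂ b)) :
    0 ≤ T2oK p ends o a₂ c b u := by
  apply T2oK_nonneg_of_mixK p ends o a₂ c b u hp
  have hH := HoK_nonneg p ends o a₂ c u hp
  have hHX := HoK_add_Xb_nonneg p ends o a₂ c b u hp
  have hβ : 0 ≤ prob p Set.univ * prob p (PDEvent ends u a₂ c) +
      prob p (avoidAll ends a₂ {c}) * prob p (avoidAll ends a₂ {u}) :=
    add_nonneg (mul_nonneg (prob_nonneg hp _) (prob_nonneg hp _))
      (mul_nonneg (prob_nonneg hp _) (prob_nonneg hp _))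
  nlinarith [mul_nonneg (sub_nonneg.2 hA) hH, mul_nonneg hβ hHX]

end Class

end MixK

end RootLeafU

end Summit.Ventures.PercRepro2
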